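import Summits.BirchSwinnertonDyer.Rank1Residual.X11b.BDPRouteManin
import Summits.BirchSwinnertonDyer.Rank1Residual.X11b.CastellaErratumLinks
import Summits.BirchSwinnertonDyer.Rank1Residual.X11b.TamagawaQuadraticBaseChange
import Literature.NumberTheory.EllipticCurves.BSDRootNumberSmallConductorProofs
import HarnessLib

/-!
# Class X11b, route "BDP + converse-theorem engine + Kolyvagin": the `Λ`-adic links behind STEP L — the open input is ONE INEQUALITY at the trivial character (cell `b2b-bsdres`, sub-cell `multr1-p2`)

HONEST FRAMING (cell `b2b-bsdres`, run/shared/lean/b2b/bsd-rank1-residual/, verbatim in every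
file): the goal of the cell is to DELETE the COMBINATION-SHAPED residual classes of the
Birch–Swinnerton-Dyer formula for ALL analytic-rank `≤ 1` elliptic curves over `ℚ` — "full BSD
formula for every rank `≤ 1` curve in class `C`" assembled STRICTLY from published theorems — so
that the rank-`≤ 1` remainder becomes exactly the CONSTRUCTION-SHAPED classes, which are TYPED
(missing-input `Prop`s), NOT attempted. This is not "finishing BSD". Sub-cell `multr1-p2` is a
RESEARCH ROUTE on class X11b; no claim beyond the stated class and locus; X11b's label does not
change. Nothing in this file is a theorem about the `Λ`-adic objects — it is valuation bookkeeping
that pins WHICH statement at `p ∥ N` route p2 is conditional on.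

Route p2's single typed input is STEP L = `IndexLowerBoundAt W p K P`
(`2·ord_p[E(K):ℤP] ≤ ord_p #Ш(E/K) + 2·ord_p ∏_ℓ c_ℓ(E/ℚ)`; Jetchev–Skinner–Wan 2017
(eq:shalowerK-1) = Castella 2018 (1.1)); `X11b/BDPRouteManin.lean` derived the sub-cell target
`X11b.Statement` from it and published named facts alone. In print STEP L is the composite of the
same four `Λ`-adic statements that route R1 (`multr1-p1`, `X11b/CastellaErratumLinks.lean`) typed
on the SHADOW `X11b.LambdaAdicShadow` (`ord_p f_ac(0)`, `ord_p L_p(f)(𝟙)`, `ord_p log_ω P`,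
`ord_p ∏_{w∣N⁺} c_w(E/K)`), EXCEPT that the main-conjecture link enters through ONE INEQUALITY:

* (IMC≥) `ord_p L_p(f)(𝟙) ≤ ord_p f_ac(0)` ⇐ "`Ch_Λ(X_ac(E[p^∞])) ⊆ (L_p(f))`" (the `p`-adic
  `L`-function divides the characteristic power series) — at a GOOD ordinary prime this is X. Wan's
  divisibility (Jetchev–Skinner–Wan 2017 §7.4.1, the input of their (eq:shalowerK-1)); at `p ∥ N` it
  is the erratum's (2.4) "By [FW21, Thm. 4.41]" — Fouquet–Wan arXiv:2107.13726, UNREFEREED —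
  transported to the `p`-new form by Castella's Hida-family congruences; X. Wan, ANT 14 (2020)
  Thm. 1.1, the published engine, presupposes a weight-2 GOOD ordinary point of the Hida family
  (`X11b/BDPRoute.lean`, module docstring). **OPEN.** `LambdaAdicShadow.IMCLowerAtTrivialChar`.
* (BDP) `ord_p L_p(f)(𝟙) = 2(ord_p log_ω P_K − 1)` — Castella JIMJ 17 (2018) / Castella 2018
  Thm. 3.2 at `p ∣ N`, PUBLISHED (`LambdaAdicShadow.WaldspurgerAt`).
* (CTL) Castella 2018 Thm. 2.3 at `p ∣ N`, `Σ = ∅`, PUBLISHED (`LambdaAdicShadow.ControlAt`).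
* (TAM) `ord_p ∏_{w∣N⁺} c_w(E/K) = ord_p ∏_w c_w(E/K)` — vacuous for a field in which EVERY
  `ℓ ∣ N` splits (`LambdaAdicShadow.TamagawaAtRamifiedAt`), and
  `ord_p ∏_w c_w(E/K) = 2·ord_p ∏_ℓ c_ℓ(E/ℚ)` is a THEOREM of the tree for such `K`
  (`padicValNat_tamagawaProduct_baseChange_of_heegner` below, from
  `padicValNat_tamagawaProduct_baseChange_quadratic_eq_two_mul`).

Results (pointwise, at a datum with `Ш(E/K)` finite — Kolyvagin for a Heegner point of infinite
order): `indexLowerBoundAt_of_shadowLinks` ((IMC≥) ∘ (BDP) ∘ (CTL) ∘ (TAM) ⇒ STEP L),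
`imcLowerAtTrivialChar_iff_indexLowerBoundAt` (given the three published links, STEP L is EXACTLY
(IMC≥)), and `imcLowerAtTrivialChar_of_imcAtTrivialChar` (route R1's open input, the EQUALITY
(IMC) = erratum Thm. 1.1 at `𝟙`, implies route p2's). So, on the published links, the open content
of route p2 is one divisibility at one character — strictly less than route R1's two-sided (IMC).
Class level: `X11b/BDPRouteManin.statement_of_indexLowerBoundAt`.

References: [JetchevSkinnerWan2017] §7.4.1 (eq:shalowerK-1); [Castella2018] Thm. 2.3, Thm. 3.2,
(1.1), (5.1)–(5.3); [Castella2018Erratum] Thm. 1.1, (2.4); [FouquetWan2021] Thm. 4.41;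
[Wan2020ANT] Thm. 1.1.
-/

noncomputable section

open scoped Classical

open WeierstrassCurve NumberField Literature.NumberTheory.EllipticCurves
  Literature.NumberTheory.EllipticCurves.ModularForms
  Literature.NumberTheory.EllipticCurves.Rank1Residual

namespace Summit.BirchSwinnertonDyer.Rank1Residual.X11b

section Links

variable {W : WeierstrassCurve ℚ} {K : Type} [Field K] [NumberField K]
  {P : (W.baseChange K).toAffine.Point}

/-- **(IMC≥) — OPEN: the one-sided divisibility at the trivial character.**
"`Ch_Λ(X_ac(E[p^∞])) ⊆ (L_p(f)) Λ_{R₀}`" (the anticyclotomic `p`-adic `L`-function divides the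
characteristic ideal of the anticyclotomic Selmer group) gives, evaluating at `𝟙`,
`ord_p L_p(f)(𝟙) ≤ ord_p f_ac(0)`. At a good ordinary `p` this is X. Wan's theorem as used in
Jetchev–Skinner–Wan 2017 §7.4.1; at `p ∥ N` its only source is the erratum to Castella 2018, display
(2.4) "By [FW21, Thm. 4.41]" (Fouquet–Wan arXiv:2107.13726, UNREFEREED; X. Wan ANT 2020 Thm. 1.1
needs a weight-2 good ordinary point of the Hida family). THE isolated open link of route p2 — ONE
inequality, versus route R1's equality `LambdaAdicShadow.IMCAtTrivialChar`. A predicate on the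
shadow; NEVER a theorem. [claim: Castella2018Erratum, status: under-review] -/
def LambdaAdicShadow.IMCLowerAtTrivialChar (S : LambdaAdicShadow W K P) : Prop :=
  S.lpTrivOrd ≤ S.charValOrd

/-- Route R1's open link (the two-sided (IMC) at `𝟙`, erratum Thm. 1.1) implies route p2's (the
one-sided (IMC≥)). Bookkeeping. [folklore] -/
theorem LambdaAdicShadow.imcLowerAtTrivialChar_of_imcAtTrivialChar (S : LambdaAdicShadow W K P)
    (h : S.IMCAtTrivialChar) : S.IMCLowerAtTrivialChar := by
  unfold LambdaAdicShadow.IMCAtTrivialChar at h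
  unfold LambdaAdicShadow.IMCLowerAtTrivialChar
  omega

variable (p : ℕ) [Fact p.Prime]

/-- **STEP L is (IMC≥) ∘ (BDP) ∘ (CTL) ∘ (TAM)** — Jetchev–Skinner–Wan 2017 §7.4.1 ("combining
Proposition (Lpf1=Sel) [Wan's divisibility] with Proposition (brooks-Af) [BDP] and the control
theorem … we obtain (eq:shalowerK-1)"), Castella 2018 (1.1). For a shadow `S` at `(E,p,K,P)`
satisfying the three PUBLISHED links and the OPEN (IMC≥), with `Ш(E/K)` finite
(`ord_p #Ш[p^∞] = ord_p #Ш`) and the Tamagawa transport value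
`ord_p ∏_w c_w(E/K) = 2·ord_p ∏_ℓ c_ℓ(E/ℚ)` (`htamK`; a theorem for Heegner `K`, below):
`IndexLowerBoundAt W p K P`. Valuation bookkeeping (the shadow's numbers cancel).
[cite: JetchevSkinnerWan2017, §7.4.1 (eq:shalowerK-1) (arXiv:1512.06894 p. 30)]
[cite: Castella2018, (1.1) (p. 2), Thm. 2.3, Thm. 3.2] -/
theorem indexLowerBoundAt_of_shadowLinks [Finite (W.baseChange K).sha] (S : LambdaAdicShadow W K P)
    (hIMC : S.IMCLowerAtTrivialChar) (hBDP : S.WaldspurgerAt) (hCTL : S.ControlAt p)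
    (hTAM : S.TamagawaAtRamifiedAt p)
    (htamK : padicValNat p (W.baseChange K).tamagawaProduct = 2 * padicValNat p W.tamagawaProduct) :
    IndexLowerBoundAt W p K P := by
  haveI : Finite (AddCommGroup.primaryComponent (W.baseChange K).sha p) :=
    Finite.of_injective _ Subtype.val_injective
  unfold LambdaAdicShadow.IMCLowerAtTrivialChar at hIMC
  unfold LambdaAdicShadow.WaldspurgerAt at hBDP
  unfold LambdaAdicShadow.ControlAt at hCTL
  unfold LambdaAdicShadow.TamagawaAtRamifiedAt at hTAM
  unfold IndexLowerBoundAt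
  rw [padicValNat_card_addPrimaryComponent] at hCTL
  rw [WeierstrassCurve.shaOrder]
  rw [htamK] at hTAM
  omega

/-- **Conversely STEP L determines the shadow's open inequality**: given (BDP), (CTL), (TAM),
finiteness of `Ш(E/K)` and the Tamagawa transport value, `IndexLowerBoundAt W p K P` holds iff
(IMC≥) does — so on the published links the OPEN content of route p2 at a datum is EXACTLY
`ord_p L_p(f)(𝟙) ≤ ord_p f_ac(0)`, one divisibility at one character, no more. Bookkeeping.
[folklore] -/
theorem imcLowerAtTrivialChar_iff_indexLowerBoundAt [Finite (W.baseChange K).sha]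
    (S : LambdaAdicShadow W K P) (hBDP : S.WaldspurgerAt) (hCTL : S.ControlAt p)
    (hTAM : S.TamagawaAtRamifiedAt p)
    (htamK : padicValNat p (W.baseChange K).tamagawaProduct = 2 * padicValNat p W.tamagawaProduct) :
    S.IMCLowerAtTrivialChar ↔ IndexLowerBoundAt W p K P := by
  refine ⟨fun h ↦ indexLowerBoundAt_of_shadowLinks p S h hBDP hCTL hTAM htamK, fun h ↦ ?_⟩
  haveI : Finite (AddCommGroup.primaryComponent (W.baseChange K).sha p) :=
    Finite.of_injective _ Subtype.val_injective
  unfold LambdaAdicShadow.WaldspurgerAt at hBDP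
  unfold LambdaAdicShadow.ControlAt at hCTL
  unfold LambdaAdicShadow.TamagawaAtRamifiedAt at hTAM
  unfold IndexLowerBoundAt at h
  unfold LambdaAdicShadow.IMCLowerAtTrivialChar
  rw [padicValNat_card_addPrimaryComponent] at hCTL
  rw [WeierstrassCurve.shaOrder] at h
  rw [htamK] at hTAM
  omega

/-- Route R1's display (A) = Cas18 (5.3) (an IDENTITY) implies route p2's STEP L at the same datum
(finite `Ш(E/K)`, Tamagawa transport value): the identity over `K` gives the inequality
(`indexLowerBoundAt_of_indexIdentityAt`). Bookkeeping relating the two sub-cells' typed inputs.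
[cite: Castella2018, (5.3) and (1.1)] -/
theorem indexLowerBoundAt_of_display53At [Finite (W.baseChange K).sha]
    (hdisp : Display53At W p K P)
    (htamK : padicValNat p (W.baseChange K).tamagawaProduct = 2 * padicValNat p W.tamagawaProduct) :
    IndexLowerBoundAt W p K P := by
  haveI : Finite (AddCommGroup.primaryComponent (W.baseChange K).sha p) :=
    Finite.of_injective _ Subtype.val_injective
  unfold Display53At at hdisp
  unfold IndexLowerBoundAt
  rw [padicValNat_card_addPrimaryComponent] at hdisp
  rw [WeierstrassCurve.shaOrder]
  rw [htamK] at hdisp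
  omega

end Links

/-! ### The Tamagawa transport value for a Heegner field is a theorem -/

/-- **`ord_p ∏_w c_w(E/K) = 2·ord_p ∏_ℓ c_ℓ(E/ℚ)` for `K` imaginary quadratic satisfying the
classical Heegner hypothesis for `N_E` and `p ≥ 5`** — Jetchev–Skinner–Wan 2017 (eq:tamK)
"`∏_w c_w(E/K) = ∏_ℓ c_ℓ(E/ℚ)²`" read `p`-adically: the tree's
`padicValNat_tamagawaProduct_baseChange_quadratic_eq_two_mul` (places of `K` regrouped along the
fibres of `w ↦ w ∩ ℤ`) with its bad-prime hypothesis vacuous (every `ℓ ∣ N_E` splits). So the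
hypothesis `htamK` of the link theorems above is discharged on the route.
[cite: JetchevSkinnerWan2017, §7.3.1 (eq:tamK)] -/
theorem padicValNat_tamagawaProduct_baseChange_of_heegner (W : WeierstrassCurve ℚ) [W.IsElliptic]
    [W.IsGloballyMinimal] (p : ℕ) [Fact p.Prime] (hp : 5 ≤ p) (K : Type) [Field K] [NumberField K]
    (hK : IsImaginaryQuadratic K) {N : ℕ} (hN : W.conductorNorm ℤ = N)
    (hH : SatisfiesHeegnerHypothesis N K) :
    padicValNat p (W.baseChange K).tamagawaProduct = 2 * padicValNat p W.tamagawaProduct :=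
  padicValNat_tamagawaProduct_baseChange_quadratic_eq_two_mul W p K hp hK.1
    (fun ℓ _ hℓN hns ↦ (hns (hH ℓ Fact.out (hN ▸ hℓN))).elim)

/-- **STEP L at a Heegner datum from the four links, with the transport value discharged**: for
`W/ℚ` globally minimal elliptic, `p ≥ 5`, `K` imaginary quadratic with the Heegner hypothesis for
`N_E`, a point `P ∈ E(K)` with `Ш(E/K)` finite, and a shadow at `(E,p,K,P)` satisfying (IMC≥)
[OPEN], (BDP), (CTL), (TAM) [PUBLISHED]: `IndexLowerBoundAt W p K P` — the hypothesis `hL` of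
`statement_of_indexLowerBoundAt` at that datum. (There `Ш(E/K)` is finite by Kolyvagin whenever the
Heegner point has infinite order; when it is torsion the route does not use the datum.)
[cite: JetchevSkinnerWan2017, §7.4.1 (eq:shalowerK-1) and §7.3.1 (eq:tamK)] -/
theorem indexLowerBoundAt_of_shadowLinks_of_heegner (W : WeierstrassCurve ℚ) [W.IsElliptic]
    [W.IsGloballyMinimal] (p : ℕ) [Fact p.Prime] (hp : 5 ≤ p) (K : Type) [Field K] [NumberField K]
    (hK : IsImaginaryQuadratic K) {N : ℕ} (hN : W.conductorNorm ℤ = N)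
    (hH : SatisfiesHeegnerHypothesis N K) {P : (W.baseChange K).toAffine.Point}
    [Finite (W.baseChange K).sha] (S : LambdaAdicShadow W K P) (hIMC : S.IMCLowerAtTrivialChar)
    (hBDP : S.WaldspurgerAt) (hCTL : S.ControlAt p) (hTAM : S.TamagawaAtRamifiedAt p) :
    IndexLowerBoundAt W p K P :=
  indexLowerBoundAt_of_shadowLinks p S hIMC hBDP hCTL hTAM
    (padicValNat_tamagawaProduct_baseChange_of_heegner W p hp K hK hN hH)

end Summit.BirchSwinnertonDyer.Rank1Residual.X11b

end
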